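import Summits.QuantumFields.YangMills.Theorems.UnitScaleTiltProp7TubeTransportCloseness
import Summits.QuantumFields.YangMills.Theorems.UnitScaleTiltProp7TrueLinIterDefect
import Summits.QuantumFields.YangMills.Theorems.UnitScaleTiltProp7CovariantTransport
import Literature.MathematicalPhysics.QuantumFieldTheory.Balaban1983to89.B5AveragingLocalityV1
import Summits.QuantumFields.YangMills.Theorems.UnitScaleTiltProp7CompetitorEnergyMember
import HarnessLib

/-!
# Route `UnitScaleTilt`, crux «MinimiserStabilityRegPr» (stmt-QuantumFields-19200, stub EX), positivity block, pen (b1)-(iv) «TOWER-vs-CORNER TRANSPORTS» —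
# FILE 2a: THE ITERATED STAIR∕LINE MEANS ARE THE FRAMED FLAT TUBE MEANS OF THE GAUGED FIELD, UP TO `O(L²ε₀)` OF THE TUBE MASS, k-UNIFORMLY
# («= the (R-C) remainder of the 20520 [RP]-curved lane, typed once here; 20520 consumers cite by name»)

Cell `ym3-torus` (rung R3 — YM₃ on T³; NOT d = 4, NOT the Clay problem).  Width seat `ym-routeR-w4` g25 (pen named by w7-19200 g10 2026-08-29 21:13:16Z, ★★OWNER WORD 52).
THEOREMS ONLY (0 `def`, 0 `sorry`); `--supports stmt-QuantumFields-19200 --as helper`; count-neutral.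

THE POINT.  For a top-level bond `c = ⟨y, μ⟩` of the d = 3 carrier (`k = K − n`) fix the CORNER axial gauge `u = axialT W♭ (corner y)` of the double block `D = B^k(y) ∪ B^k(y + e_μ)`
(✓`Prop7TubeTransportCloseness`: every fine bond of `D` is `s₀`-close to `1` after gauging, every gauged tower transport along a word of `m` steps inside `D` is `m·σ_j`-close to `1`,
`σ_j ≤ 1800Lε₀·Lʲη`).  The pure `LINE` iterate `S_j` of ✓`Prop7TrueLinIterDefect` (stair-transported covariant straight-line means along `W`'s (0.4) tower) then satisfies, on
every level-`j` bond `e` whose endpoints' fine blocks lie in `D`: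
  `‖S_j(e) − Ad_{u(ê)⁻¹} N_j(e)‖ ≤ θ_j·m_j(e)`, `‖S_j(e)‖ ≤ m_j(e)`,  `ê = embIter j e₋`,
with the FLAT model `N_j = Lʲ·bondAvgIter j (Ad_{u(b₋)}A)` ([Balaban1984PropagatorsI] (1.16)–(1.18): the iterated plain bond average of the gauged field), the tube mass
`m_j = Lʲ·bondAvgIter j ‖A‖` and `θ_j = Σ_{i<j} 21600L²ε₀·Lⁱη ≤ 10800L²ε₀` — induction on DEFECT's `hSs` (unrolled by ✓`covWalkSum_walk_replicate_true`): each stair-plus-run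
transport is `10800L²ε₀Lʲη`-close to the reference `u(p̂)⁻¹u(ê)` (✓`norm_holT_tower_gauged_sub_one_le`), conjugations by near references differ by twice that
(✓`norm_conjR_sub_conjR_le`), and the flat recursion of `bondAvgIter` re-assembles the model (the two permutation indices of (0.4) are idle).
HONEST SCOPE.  Bookkeeping over landed letters + [Balaban1985Averaging] Prop. 4 as landed; (iv)'s final row is FILE 2b; `hQcmp`, the γ-row, the print rows, EX, the crux are NOT proved here.
References: T. Bałaban, CMP **98** (1985) 17–51 [Balaban1985Averaging] ((8)–(11) pp.18–19, (58) p.27, Prop. 4 (134)–(135) p.38); CMP **95** (1984) 17–40 [Balaban1984PropagatorsI]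
((1.16)–(1.18) p.20); CMP **99** (1985) 75–102 [Balaban1985RegularSpaces] (Lemma 1 (1.25) p.79).
-/

set_option autoImplicit false

noncomputable section

open scoped BigOperators Matrix.Norms.L2Operator

namespace Summit.QuantumFields.YangMills.Theorems.Prop7TubeStrLineIterRefMean

open Literature.MathematicalPhysics.QuantumFieldTheory.Balaban1983to89
open Literature.MathematicalPhysics.QuantumFieldTheory.Balaban1983to89.T3ContinuumYM3Torus
open Finset T4Continuum BlockAveraging AveragingRT ExpMeanLog BlockAveragingEMLLinearised BlockAveragingEMLLinearisedBackground BlockAveragingEMLProp2 LatticeFieldCalculus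
open B5Eq118OneStroke (iterBlockOf iterBlock mem_iterBlock iterBlockOf_zero iterBlockOf_succ)
open B15DeterminingSets (embIter)
open B7Prop1Explicit (U1 mem_U1 treeWord l1)
open B7Eq78Linearization (conjR conjR_apply conjR_sub conjR_smul conjR_smul_real)
open B8Ineq132 (norm_conjR norm_conjR_le conjR_conjR one_conjR conjR_sum)
open B10Eq27TorusAxialLog (holT axialT axialT_self gaugeActT gaugeActT_apply unitsField toUField holT_eq_holAt)
open T3RegularMinimiser (regThreshold regThreshold_pos)
open T3SectALandauChart (eta eta_pos bgUnits)
open Summit.QuantumFields.YangMills.Theorems.Prop8Chart (emlIterU)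
open Summit.QuantumFields.YangMills.Theorems.Prop7SymAvgTwSym (holT_mem_U1 unitsField_toUField_mem_U1' pow_mul_eta_eq_one pow_mul_eta_le_one)
open Summit.QuantumFields.YangMills.Theorems.Prop7SymAvgGLSmallOfRegPr (unitsField_toUField_iter_of_plaqSmall_T3 bgUnits_eq)
open Summit.QuantumFields.YangMills.Theorems.Prop7SymAvgGL (iterGL_eq_emlIterU)
open Summit.QuantumFields.YangMills.Theorems.Prop7TowerClosenessOfRegPr (holT_unitsField_toUField_eq_map coe_map_eq)
open Summit.QuantumFields.YangMills.Theorems.Prop7NestedMeanTowerCloseness (emlIterU_bgUnits_mem_U1_of_plaqSmall)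
open Summit.QuantumFields.YangMills.Theorems.Prop7NestedMeanPoincare (sum_idx_fst)
open Summit.QuantumFields.YangMills.Theorems.Prop7CovariantCoercivity (norm_conjR_sub_conjR_le)
open Summit.QuantumFields.YangMills.Theorems.Prop7TubeTransportCloseness
open Summit.QuantumFields.YangMills.Theorems.ChartHInv (blockOf_of_mem_walk_stairWord)
open B5AveragingLocalityV1 (blockOf_runSite_blockSite_or)

variable (F : T3Family) {n K : ℕ}

/-! ## §1 Two algebra letters -/

/-- Conjugations by a transport and by a reference differ by twice the gauged defect: `‖Ad_g X − Ad_{a⁻¹b} X‖ ≤ 2‖a·g·b⁻¹ − 1‖·‖X‖` (`a, b, g` contractive units).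
[cite: Balaban1985Averaging, (19)-(20) p.21] -/
theorem norm_conjR_sub_conjR_ref_le {a b g : (Matrix (Fin 2) (Fin 2) ℂ)ˣ} (ha : a ∈ U1 (Matrix (Fin 2) (Fin 2) ℂ)) (hb : b ∈ U1 (Matrix (Fin 2) (Fin 2) ℂ)) (hg : g ∈ U1 (Matrix (Fin 2) (Fin 2) ℂ)) (X : Matrix (Fin 2) (Fin 2) ℂ) :
    ‖conjR g X - conjR (a⁻¹ * b) X‖ ≤ 2 * ‖(a : Matrix (Fin 2) (Fin 2) ℂ) * (g : Matrix (Fin 2) (Fin 2) ℂ) * ((b⁻¹ : (Matrix (Fin 2) (Fin 2) ℂ)ˣ) : Matrix (Fin 2) (Fin 2) ℂ) - 1‖ * ‖X‖ := by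
  have hab : a⁻¹ * b ∈ U1 (Matrix (Fin 2) (Fin 2) ℂ) := (U1 _).mul_mem ((U1 _).inv_mem ha) hb
  refine (norm_conjR_sub_conjR_le hab hg X).trans ?_
  have hid : (g : Matrix (Fin 2) (Fin 2) ℂ) - ((a⁻¹ * b : (Matrix (Fin 2) (Fin 2) ℂ)ˣ) : Matrix (Fin 2) (Fin 2) ℂ) = ((a⁻¹ : (Matrix (Fin 2) (Fin 2) ℂ)ˣ) : Matrix (Fin 2) (Fin 2) ℂ) * ((a : Matrix (Fin 2) (Fin 2) ℂ) * (g : Matrix (Fin 2) (Fin 2) ℂ) * ((b⁻¹ : (Matrix (Fin 2) (Fin 2) ℂ)ˣ) : Matrix (Fin 2) (Fin 2) ℂ) - 1) * (b : Matrix (Fin 2) (Fin 2) ℂ) := by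
    rw [Units.val_mul, mul_sub, sub_mul, mul_one, ← mul_assoc, ← mul_assoc, Units.inv_mul, one_mul, mul_assoc _ ((b⁻¹ : (Matrix (Fin 2) (Fin 2) ℂ)ˣ) : Matrix (Fin 2) (Fin 2) ℂ), Units.inv_mul, mul_one]
  have hle : ‖(g : Matrix (Fin 2) (Fin 2) ℂ) - ((a⁻¹ * b : (Matrix (Fin 2) (Fin 2) ℂ)ˣ) : Matrix (Fin 2) (Fin 2) ℂ)‖ ≤ ‖(a : Matrix (Fin 2) (Fin 2) ℂ) * (g : Matrix (Fin 2) (Fin 2) ℂ) * ((b⁻¹ : (Matrix (Fin 2) (Fin 2) ℂ)ˣ) : Matrix (Fin 2) (Fin 2) ℂ) - 1‖ := by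
    rw [hid]
    calc _ ≤ ‖((a⁻¹ : (Matrix (Fin 2) (Fin 2) ℂ)ˣ) : Matrix (Fin 2) (Fin 2) ℂ)‖ * ‖(a : Matrix (Fin 2) (Fin 2) ℂ) * (g : Matrix (Fin 2) (Fin 2) ℂ) * ((b⁻¹ : (Matrix (Fin 2) (Fin 2) ℂ)ˣ) : Matrix (Fin 2) (Fin 2) ℂ) - 1‖ * ‖(b : Matrix (Fin 2) (Fin 2) ℂ)‖ :=
          (norm_mul_le _ _).trans (mul_le_mul_of_nonneg_right (norm_mul_le _ _) (norm_nonneg _))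
      _ ≤ 1 * ‖(a : Matrix (Fin 2) (Fin 2) ℂ) * (g : Matrix (Fin 2) (Fin 2) ℂ) * ((b⁻¹ : (Matrix (Fin 2) (Fin 2) ℂ)ˣ) : Matrix (Fin 2) (Fin 2) ℂ) - 1‖ * 1 := by
          gcongr
          · exact (mem_U1.1 ha).2
          · exact (mem_U1.1 hb).1
      _ = _ := by rw [one_mul, mul_one]
  nlinarith [norm_nonneg X, hle, norm_nonneg ((a : Matrix (Fin 2) (Fin 2) ℂ) * (g : Matrix (Fin 2) (Fin 2) ℂ) * ((b⁻¹ : (Matrix (Fin 2) (Fin 2) ℂ)ˣ) : Matrix (Fin 2) (Fin 2) ℂ) - 1)]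

/-- `Ad_{a⁻¹b}(Ad_{b⁻¹} Y) = Ad_{a⁻¹} Y`. [folklore] -/
theorem conjR_ref_conjR_inv (a b : (Matrix (Fin 2) (Fin 2) ℂ)ˣ) (Y : Matrix (Fin 2) (Fin 2) ℂ) : conjR (a⁻¹ * b) (conjR b⁻¹ Y) = conjR a⁻¹ Y := by
  rw [conjR_conjR, mul_assoc, mul_inv_cancel, mul_one]

section Generic
variable {P : Params}

/-- `‖bondAvgIter j Z e‖ ≤ bondAvgIter j ‖Z‖ e` (the iterated bond average is a nonnegative-weighted sum). [cite: Balaban1984PropagatorsI, (1.16)-(1.18) p.20] -/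
theorem norm_bondAvgIter_le : ∀ (j : ℕ) (Z : VecField P 0 (Matrix (Fin 2) (Fin 2) ℂ)) (e : PBond P j),
    ‖bondAvgIter j Z e‖ ≤ bondAvgIter j (fun b => ‖Z b‖) e
  | 0, Z, e => le_rfl
  | j + 1, Z, e => by
    show ‖(((P.L : ℝ) ^ (P.d + 1))⁻¹) • ∑ r : Fin P.d → Fin P.L, segSum (bondAvgIter j Z) (Site.blockSite e.src r) e.dir P.L‖
      ≤ (((P.L : ℝ) ^ (P.d + 1))⁻¹) • ∑ r : Fin P.d → Fin P.L, segSum (bondAvgIter j fun b => ‖Z b‖) (Site.blockSite e.src r) e.dir P.L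
    have hw : 0 ≤ ((P.L : ℝ) ^ (P.d + 1))⁻¹ := by positivity
    rw [norm_smul, Real.norm_of_nonneg hw, smul_eq_mul]
    refine mul_le_mul_of_nonneg_left ((norm_sum_le _ _).trans (Finset.sum_le_sum fun r _ => ?_)) hw
    unfold segSum
    exact (norm_sum_le _ _).trans (Finset.sum_le_sum fun t _ => norm_bondAvgIter_le j Z _)

/-- **THE FLAT RECURSION OVER THE (0.4) INDEX SET** (matrix-valued): `L^{j+1}·bondAvgIter (j+1) Z c = |Idx|⁻¹·Σ_i Σ_{t<L} L^j·bondAvgIter j Z ⟨x_{c,i} + te_μ, μ⟩` (the two permutation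
indices are idle, ✓`sum_idx_fst`). [cite: Balaban1984PropagatorsI, (1.16)-(1.18) p.20; Balaban1987RG1, (0.4) p.253] -/
theorem smul_bondAvgIter_succ_eq (j : ℕ) (Z : VecField P 0 (Matrix (Fin 2) (Fin 2) ℂ)) (c : PBond P (j + 1)) :
    ((P.L : ℝ) ^ (j + 1)) • bondAvgIter (j + 1) Z c
      = ((Fintype.card (Idx P) : ℂ))⁻¹ • ∑ i : Idx P, ∑ t ∈ Finset.range P.L,
          ((P.L : ℝ) ^ j) • bondAvgIter j Z ⟨runSite (Site.blockSite c.src i.1) c.dir t, c.dir⟩ := by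
  have hL : (0 : ℝ) < P.L := by exact_mod_cast P.L_pos
  have hP : (0 : ℝ) < (Fintype.card (Equiv.Perm (Fin P.d)) * Fintype.card (Equiv.Perm (Fin P.d)) : ℕ) := by
    exact_mod_cast Nat.mul_pos Fintype.card_pos Fintype.card_pos
  have card_idx_eq : (Fintype.card (Idx P) : ℝ) = (P.L : ℝ) ^ P.d * (Fintype.card (Equiv.Perm (Fin P.d)) * Fintype.card (Equiv.Perm (Fin P.d)) : ℕ) := by
    simp only [Idx, Fintype.card_prod, Fintype.card_fun, Fintype.card_fin]; push_cast; ring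
  rw [sum_idx_fst (fun r => ∑ t ∈ Finset.range P.L, ((P.L : ℝ) ^ j) • bondAvgIter j Z ⟨runSite (Site.blockSite c.src r) c.dir t, c.dir⟩)]
  show ((P.L : ℝ) ^ (j + 1)) • ((((P.L : ℝ) ^ (P.d + 1))⁻¹) • ∑ r : Fin P.d → Fin P.L, ∑ t ∈ Finset.range P.L, bondAvgIter j Z ⟨runSite (Site.blockSite c.src r) c.dir t, c.dir⟩) = _
  rw [← Nat.cast_smul_eq_nsmul ℂ, smul_smul]
  simp only [← Finset.smul_sum]
  rw [smul_smul, Prop7CompetitorEnergyMember.real_smul_eq_coe_smul, Prop7CompetitorEnergyMember.real_smul_eq_coe_smul, smul_smul]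
  congr 1
  have hI : (Fintype.card (Idx P) : ℂ) = ((P.L : ℂ) ^ P.d) * ((Fintype.card (Equiv.Perm (Fin P.d)) * Fintype.card (Equiv.Perm (Fin P.d)) : ℕ) : ℂ) := by
    have := card_idx_eq; apply_fun ((↑) : ℝ → ℂ) at this; push_cast at this ⊢; exact this
  rw [hI]
  have hL' : (P.L : ℂ) ≠ 0 := by exact_mod_cast hL.ne'
  have hP' : ((Fintype.card (Equiv.Perm (Fin P.d)) * Fintype.card (Equiv.Perm (Fin P.d)) : ℕ) : ℂ) ≠ 0 := by exact_mod_cast hP.ne'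
  push_cast
  field_simp
  ring

/-- The same recursion for the real tube mass `Lʲ·bondAvgIter j ‖A‖`. [cite: Balaban1984PropagatorsI, (1.16)-(1.18) p.20] -/
theorem mul_bondAvgIter_succ_eq (j : ℕ) (f : VecField P 0 ℝ) (c : PBond P (j + 1)) :
    (P.L : ℝ) ^ (j + 1) * bondAvgIter (j + 1) f c
      = ((Fintype.card (Idx P) : ℝ))⁻¹ * ∑ i : Idx P, ∑ t ∈ Finset.range P.L,
          (P.L : ℝ) ^ j * bondAvgIter j f ⟨runSite (Site.blockSite c.src i.1) c.dir t, c.dir⟩ := by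
  have hL : (0 : ℝ) < P.L := by exact_mod_cast P.L_pos
  have hP : (0 : ℝ) < (Fintype.card (Equiv.Perm (Fin P.d)) * Fintype.card (Equiv.Perm (Fin P.d)) : ℕ) := by
    exact_mod_cast Nat.mul_pos Fintype.card_pos Fintype.card_pos
  have card_idx_eq : (Fintype.card (Idx P) : ℝ) = (P.L : ℝ) ^ P.d * (Fintype.card (Equiv.Perm (Fin P.d)) * Fintype.card (Equiv.Perm (Fin P.d)) : ℕ) := by
    simp only [Idx, Fintype.card_prod, Fintype.card_fun, Fintype.card_fin]; push_cast; ring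
  rw [sum_idx_fst (fun r => ∑ t ∈ Finset.range P.L, (P.L : ℝ) ^ j * bondAvgIter j f ⟨runSite (Site.blockSite c.src r) c.dir t, c.dir⟩)]
  show (P.L : ℝ) ^ (j + 1) * ((((P.L : ℝ) ^ (P.d + 1))⁻¹) • ∑ r : Fin P.d → Fin P.L, ∑ t ∈ Finset.range P.L, bondAvgIter j f ⟨runSite (Site.blockSite c.src r) c.dir t, c.dir⟩) = _
  rw [nsmul_eq_mul, smul_eq_mul, card_idx_eq]
  simp only [← Finset.mul_sum]
  field_simp
  ring
end Generic

/-! ## §2 ★★ The induction: iterated stair∕line means vs the framed flat tube means of the gauged field -/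

/-- ★★ **`S_j` IS THE FRAMED FLAT TUBE MEAN OF THE GAUGED FIELD UP TO `θ_j` × THE TUBE MASS.**  `W` with `PlaqSmall (regThreshold F n K ε₀) W`, `10⁷L³ε₀ ≤ 1`; `c = ⟨y, μ⟩` a top-level bond;
`u = axialT W♭ (corner y)`; `S` DEFECT's pure `LINE` iterate (`hS0 ∕ hSs`).  For every level `j ≤ K − n` and every level-`j` bond `e` whose endpoints' fine `j`-blocks lie in `B^k(y) ∪ B^k(y + e_μ)`:
`‖S j e − Ad_{u(embIter j e₋)⁻¹}(Lʲ·bondAvgIter j (Ad_{u(b₋)}A) e)‖ ≤ (Σ_{i<j} 21600L²ε₀·Lⁱη)·(Lʲ·bondAvgIter j ‖A‖ e)` and `‖S j e‖ ≤ Lʲ·bondAvgIter j ‖A‖ e`.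
[cite: Balaban1985Averaging, (58) p.27, Prop. 4 (134)-(135) p.38; Balaban1984PropagatorsI, (1.16)-(1.18) p.20; Balaban1985RegularSpaces, Lemma 1 (1.25) p.79] -/
theorem lineIter_sub_refMean_le {ε₀ : ℝ} (hε₀ : 0 < ε₀) (hε7 : 10 ^ 7 * (F.L : ℝ) ^ 3 * ε₀ ≤ 1)
    (W : GaugeField (F.P K) 0 (Matrix.specialUnitaryGroup (Fin 2) ℂ)) (hW : PlaqSmall (regThreshold F n K ε₀) W)
    (A : PBond (F.P K) 0 → Matrix (Fin 2) (Fin 2) ℂ)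
    (S : (k : ℕ) → PBond (F.P K) k → Matrix (Fin 2) (Fin 2) ℂ) (hS0 : ∀ b, S 0 b = A b)
    (hSs : ∀ (k : ℕ) (c : PBond (F.P K) (k + 1)), S (k + 1) c
      = ((Fintype.card (Idx (F.P K)) : ℂ))⁻¹ • ∑ i : Idx (F.P K),
          (((holAt (Averaging.iter (fun i => blockAvg (P := F.P K) (j := i) (expMeanLogSU (n := Fin 2))) k W) (walk (emb c.src) (stairWord i.2.1 (off i.1))) : Matrix.specialUnitaryGroup (Fin 2) ℂ) : Matrix (Fin 2) (Fin 2) ℂ) *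
            covWalkSum (Averaging.iter (fun i => blockAvg (P := F.P K) (j := i) (expMeanLogSU (n := Fin 2))) k W) (S k)
              (walk (walkEnd (emb c.src) (stairWord i.2.1 (off i.1))) (List.replicate (F.P K).L (c.dir, true))) *
          star ((holAt (Averaging.iter (fun i => blockAvg (P := F.P K) (j := i) (expMeanLogSU (n := Fin 2))) k W) (walk (emb c.src) (stairWord i.2.1 (off i.1))) : Matrix.specialUnitaryGroup (Fin 2) ℂ) : Matrix (Fin 2) (Fin 2) ℂ)))
    (y : Site (F.P K) (K - n)) (μ : Fin (F.P K).d) :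
    ∀ j : ℕ, j ≤ K - n → ∀ e : PBond (F.P K) j,
      (∀ x' : Site (F.P K) 0, iterBlockOf j x' = e.src → iterBlockOf (K - n) x' = y ∨ iterBlockOf (K - n) x' = y.shift μ) →
      (∀ x' : Site (F.P K) 0, iterBlockOf j x' = e.tgt → iterBlockOf (K - n) x' = y ∨ iterBlockOf (K - n) x' = y.shift μ) →
      ‖S j e - conjR (axialT (bgUnits F K W) (Site.fibreSite 0 (K - n) y fun _ => (⟨0, pow_pos (F.P K).L_pos (K - n)⟩ : Fin ((F.P K).L ^ (K - n)))) (embIter j e.src))⁻¹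
            (((F.L : ℝ) ^ j) • bondAvgIter j (fun b => conjR (axialT (bgUnits F K W) (Site.fibreSite 0 (K - n) y fun _ => (⟨0, pow_pos (F.P K).L_pos (K - n)⟩ : Fin ((F.P K).L ^ (K - n)))) b.src) (A b)) e)‖
          ≤ (∑ i ∈ Finset.range j, 21600 * (F.L : ℝ) ^ 2 * ε₀ * ((F.L : ℝ) ^ i * eta F n K))
            * ((F.L : ℝ) ^ j * bondAvgIter j (fun b => ‖A b‖) e)
      ∧ ‖S j e‖ ≤ (F.L : ℝ) ^ j * bondAvgIter j (fun b => ‖A b‖) e := by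
  intro j
  induction j with
  | zero =>
    intro _ e _ _
    have h1 : bondAvgIter 0 (fun b => conjR (axialT (bgUnits F K W) (Site.fibreSite 0 (K - n) y fun _ => (⟨0, pow_pos (F.P K).L_pos (K - n)⟩ : Fin ((F.P K).L ^ (K - n)))) b.src) (A b)) e = conjR (axialT (bgUnits F K W) (Site.fibreSite 0 (K - n) y fun _ => (⟨0, pow_pos (F.P K).L_pos (K - n)⟩ : Fin ((F.P K).L ^ (K - n)))) e.src) (A e) := rfl
    have h2 : bondAvgIter 0 (fun b : PBond (F.P K) 0 => ‖A b‖) e = ‖A e‖ := rfl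
    have h3 : embIter 0 e.src = e.src := rfl
    rw [hS0, h1, h2, h3, pow_zero, one_smul, one_mul, Finset.sum_range_zero, zero_mul, conjR_conjR, inv_mul_cancel, one_conjR,
      sub_self, norm_zero]
    exact ⟨le_rfl, le_rfl⟩
  | succ j ih =>
    intro hj c' hsrc htgt
    have hjK : j ≤ K - n := Nat.le_of_succ_le hj
    have hk : K - n ≤ (F.P K).m + (F.P K).K := by show K - n ≤ F.m + K; omega
    have hj1 : j + 1 ≤ (F.P K).m + (F.P K).K := hj.trans hk
    have hjm : j ≤ (F.P K).m + (F.P K).K := hjK.trans hk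
    have hd : (F.P K).d = 3 := T3Family.P_d F K
    have hLL : ((F.P K).L : ℝ) = F.L := rfl
    have hL3 : (3 : ℝ) ≤ F.L := by
      have h3 : 3 ≤ F.L := by obtain ⟨a, ha⟩ := F.hL.1; have := F.hL.2; omega
      exact_mod_cast h3
    have hη : 0 < eta F n K := eta_pos F n K
    -- letters
    set q₀ := (Site.fibreSite 0 (K - n) y fun _ => (⟨0, pow_pos (F.P K).L_pos (K - n)⟩ : Fin ((F.P K).L ^ (K - n)))) with hq₀
    set u : Site (F.P K) 0 → (Matrix (Fin 2) (Fin 2) ℂ)ˣ := axialT (bgUnits F K W) q₀ with hu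
    set V := Averaging.iter (fun i => blockAvg (P := F.P K) (j := i) (expMeanLogSU (n := Fin 2))) j W with hV
    set s₀ : ℝ := 2 * ((3 : ℝ) * (2 * (F.L : ℝ) ^ (K - n) - 1)) * regThreshold F n K ε₀ with hs₀def
    set σ : ℝ := 30 * ((((F.P K).d + 2) * (F.P K).L : ℕ) : ℝ) * ((F.P K).L : ℝ) ^ j * s₀ with hσ
    set η' : ℝ := 21600 * (F.L : ℝ) ^ 2 * ε₀ * ((F.L : ℝ) ^ j * eta F n K) with hη'
    set θ : ℝ := ∑ i ∈ Finset.range j, 21600 * (F.L : ℝ) ^ 2 * ε₀ * ((F.L : ℝ) ^ i * eta F n K) with hθ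
    set mf : (i : ℕ) → PBond (F.P K) i → ℝ := fun i e => (F.L : ℝ) ^ i * bondAvgIter i (fun b => ‖A b‖) e with hmf
    set Nf : (i : ℕ) → PBond (F.P K) i → Matrix (Fin 2) (Fin 2) ℂ := fun i e => ((F.L : ℝ) ^ i) • bondAvgIter i (fun b => conjR (u b.src) (A b)) e with hNf
    have hs₀ : 0 ≤ s₀ := by
      have := (regThreshold_pos F (n := n) (K := K) hε₀).le
      have hL1 : (1 : ℝ) ≤ (F.L : ℝ) ^ (K - n) := one_le_pow₀ (by linarith)
      have : (0 : ℝ) ≤ 2 * (F.L : ℝ) ^ (K - n) - 1 := by linarith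
      positivity
    obtain ⟨hbud, hσle⟩ := budget_twoBlock_T3 F (n := n) (K := K) hε₀ hε7 hjK
    have hθ0 : 0 ≤ θ := Finset.sum_nonneg fun i _ => by positivity
    -- the per-word defect `6L·σ ≤ η'∕2`
    have hword : (6 * (F.L : ℝ)) * σ ≤ η' / 2 := by
      have h := mul_le_mul_of_nonneg_left hσle (by positivity : (0 : ℝ) ≤ 6 * F.L)
      rw [hσ]; rw [hη']; linarith [h]
    -- `U1` facts
    have hW1 : ∀ b, bgUnits F K W b ∈ U1 (Matrix (Fin 2) (Fin 2) ℂ) := fun b => unitsField_toUField_mem_U1' W b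
    have hu1 : ∀ x, u x ∈ U1 (Matrix (Fin 2) (Fin 2) ℂ) := fun x => by rw [hu]; unfold axialT; exact holT_mem_U1 hW1 _ _
    have hUj : ∀ b : PBond (F.P K) j, emlIterU j (bgUnits F K W) b ∈ U1 (Matrix (Fin 2) (Fin 2) ℂ) := fun b => emlIterU_bgUnits_mem_U1_of_plaqSmall F hε₀ hε7 W hW hjK b
    -- the level-`j` region and the two-block bond bound
    set Sj : Set (Site (F.P K) j) := {v | ∀ x' : Site (F.P K) 0, iterBlockOf j x' = v → iterBlockOf (K - n) x' = y ∨ iterBlockOf (K - n) x' = y.shift μ} with hSj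
    have hax : ∀ b : PBond (F.P K) 0, iterBlockOf j b.src ∈ Sj → iterBlockOf j b.tgt ∈ Sj → ‖((gaugeActT u (bgUnits F K W) b : (Matrix (Fin 2) (Fin 2) ℂ)ˣ) : Matrix (Fin 2) (Fin 2) ℂ) - 1‖ ≤ s₀ :=
      fun b hs ht => norm_axialGauge_bond_sub_one_le_twoBlock_T3 F hε₀ W hW y μ b (hs b.src rfl) (ht b.tgt rfl)
    -- the units tower at level `j` is the `SU(2)` tower
    have hEj : emlIterU j (bgUnits F K W) = unitsField (toUField V) := by
      rw [hV, bgUnits_eq, ← iterGL_eq_emlIterU, ← unitsField_toUField_iter_of_plaqSmall_T3 F n K hε₀ hε7 W hW hjK]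
    have hhol : ∀ (p : Site (F.P K) j) (Γ : List (Letter (F.P K).d)),
        ((holT (emlIterU j (bgUnits F K W)) p Γ : (Matrix (Fin 2) (Fin 2) ℂ)ˣ) : Matrix (Fin 2) (Fin 2) ℂ) = ((holAt V (walk p Γ) : Matrix.specialUnitaryGroup (Fin 2) ℂ) : Matrix (Fin 2) (Fin 2) ℂ) ∧
        (((holT (emlIterU j (bgUnits F K W)) p Γ)⁻¹ : (Matrix (Fin 2) (Fin 2) ℂ)ˣ) : Matrix (Fin 2) (Fin 2) ℂ) = star ((holAt V (walk p Γ) : Matrix.specialUnitaryGroup (Fin 2) ℂ) : Matrix (Fin 2) (Fin 2) ℂ) := by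
      intro p Γ
      rw [hEj, holT_unitsField_toUField_eq_map, ← map_inv, coe_map_eq, coe_map_eq, holT_eq_holAt]
      exact ⟨rfl, rfl⟩
    -- the line bonds `e_{i,t}` and their regions
    have hreg : ∀ (r : Fin (F.P K).d → Fin (F.P K).L) (s : ℕ), s ≤ (F.P K).L → runSite (Site.blockSite c'.src r) c'.dir s ∈ Sj := by
      intro r s hs x' hx'
      have hb := blockOf_runSite_blockSite_or hj1 c'.src r c'.dir hs
      have h1 : iterBlockOf (j + 1) x' = blockOf (runSite (Site.blockSite c'.src r) c'.dir s) := by rw [iterBlockOf_succ, hx']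
      rcases hb with hb | hb
      · exact hsrc x' (by rw [h1, hb])
      · exact htgt x' (by rw [h1, hb]; rfl)
    have hIH : ∀ (r : Fin (F.P K).d → Fin (F.P K).L) (t : ℕ), t < (F.P K).L →
        ‖S j ⟨runSite (Site.blockSite c'.src r) c'.dir t, c'.dir⟩ - conjR (u (embIter j (runSite (Site.blockSite c'.src r) c'.dir t)))⁻¹
              (Nf j ⟨runSite (Site.blockSite c'.src r) c'.dir t, c'.dir⟩)‖ ≤ θ * mf j ⟨runSite (Site.blockSite c'.src r) c'.dir t, c'.dir⟩
        ∧ ‖S j ⟨runSite (Site.blockSite c'.src r) c'.dir t, c'.dir⟩‖ ≤ mf j ⟨runSite (Site.blockSite c'.src r) c'.dir t, c'.dir⟩ := by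
      intro r t ht
      have h2 := hreg r (t + 1) ht
      rw [runSite_succ] at h2
      exact ih hjK ⟨runSite (Site.blockSite c'.src r) c'.dir t, c'.dir⟩ (hreg r t ht.le) h2
    -- ★ the per-term estimate
    have hterm : ∀ (i : Idx (F.P K)) (t : ℕ), t < (F.P K).L →
        ‖((holAt V (walk (emb c'.src) (stairWord i.2.1 (off i.1) ++ List.replicate t (c'.dir, true))) : Matrix.specialUnitaryGroup (Fin 2) ℂ) : Matrix (Fin 2) (Fin 2) ℂ)
            * S j ⟨runSite (Site.blockSite c'.src i.1) c'.dir t, c'.dir⟩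
            * star ((holAt V (walk (emb c'.src) (stairWord i.2.1 (off i.1) ++ List.replicate t (c'.dir, true))) : Matrix.specialUnitaryGroup (Fin 2) ℂ) : Matrix (Fin 2) (Fin 2) ℂ)
          - conjR (u (embIter (j + 1) c'.src))⁻¹ (Nf j ⟨runSite (Site.blockSite c'.src i.1) c'.dir t, c'.dir⟩)‖
          ≤ (θ + η') * mf j ⟨runSite (Site.blockSite c'.src i.1) c'.dir t, c'.dir⟩ := by
      intro i t ht
      set e : PBond (F.P K) j := ⟨runSite (Site.blockSite c'.src i.1) c'.dir t, c'.dir⟩ with he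
      set Γ := stairWord i.2.1 (off i.1) ++ List.replicate t (c'.dir, true) with hΓ
      set p := emb c'.src with hp
      obtain ⟨ihb, ihn⟩ := hIH i.1 t ht
      -- the steps of `Γ` stay in `Sj`
      have hΓS : ∀ st ∈ walk p Γ, st.bond.src ∈ Sj ∧ st.bond.tgt ∈ Sj := by
        intro st hst
        rw [hΓ, walk_append] at hst
        rcases List.mem_append.mp hst with hst | hst
        · have hb := blockOf_of_mem_walk_stairWord hj1 c'.src i.2.1 i.1 hst
          constructor
          · intro x' hx'; exact hsrc x' (by rw [iterBlockOf_succ, hx', hb.1])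
          · intro x' hx'; exact hsrc x' (by rw [iterBlockOf_succ, hx', hb.2])
        · rw [hp, walkEnd_emb_stairWord_eq_blockSite] at hst
          obtain ⟨s, hs, hst'⟩ := exists_of_mem_walk_replicate_true hst
          rw [hst']
          constructor
          · exact hreg i.1 s (by omega)
          · show (runSite (Site.blockSite c'.src i.1) c'.dir s).shift c'.dir ∈ Sj
            rw [← runSite_succ]; exact hreg i.1 (s + 1) (by omega)
      -- transport closeness along `Γ`
      have hend : walkEnd p Γ = e.src := by
        rw [hΓ, walkEnd_append, hp, walkEnd_emb_stairWord_eq_blockSite, Prop7TubeTransportCloseness.walkEnd_replicate_true]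
      have hclose := norm_holT_tower_gauged_sub_one_le hjm (bgUnits F K W) hUj u hu1 hs₀ hbud Sj hax p Γ hΓS
      have hlen : (Γ.length : ℝ) ≤ 6 * (F.L : ℝ) := by
        have h1 := length_walk_stairWord_le p i.2.1 i.1
        rw [length_walk] at h1
        have h2 : Γ.length ≤ ((F.P K).d + 2) * (F.P K).L + (F.P K).L := by
          rw [hΓ, List.length_append, List.length_replicate]; omega
        have h3 : ((Γ.length : ℕ) : ℝ) ≤ ((((F.P K).d + 2) * (F.P K).L + (F.P K).L : ℕ) : ℝ) := by exact_mod_cast h2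
        have hd' : ((F.P K).d : ℝ) = 3 := by exact_mod_cast hd
        push_cast at h3; rw [hLL, hd'] at h3; linarith
      have hσ0 : 0 ≤ σ := by positivity
      have hdef : ‖((u (embIter j p) * holT (emlIterU j (bgUnits F K W)) p Γ * (u (embIter j (walkEnd p Γ)))⁻¹ : (Matrix (Fin 2) (Fin 2) ℂ)ˣ) : Matrix (Fin 2) (Fin 2) ℂ) - 1‖ ≤ η' / 2 :=
        hclose.trans ((mul_le_mul_of_nonneg_right hlen hσ0).trans hword)
      rw [hend] at hdef
      -- the frames: `embIter j (emb c'.src) = embIter (j+1) c'.src`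
      have hpe : embIter j p = embIter (j + 1) c'.src := rfl
      rw [hpe] at hdef
      -- the holonomy as a unit
      set Gu : (Matrix (Fin 2) (Fin 2) ℂ)ˣ := holT (emlIterU j (bgUnits F K W)) p Γ with hGu
      have hG1 : Gu ∈ U1 (Matrix (Fin 2) (Fin 2) ℂ) := holT_mem_U1 hUj _ _
      have hconj : ((holAt V (walk p Γ) : Matrix.specialUnitaryGroup (Fin 2) ℂ) : Matrix (Fin 2) (Fin 2) ℂ) * S j e * star ((holAt V (walk p Γ) : Matrix.specialUnitaryGroup (Fin 2) ℂ) : Matrix (Fin 2) (Fin 2) ℂ) = conjR Gu (S j e) := by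
        rw [conjR_apply, ← (hhol p Γ).2, ← (hhol p Γ).1]
      rw [hconj]
      -- split: transported IH defect + reference change
      have hsplit : conjR Gu (S j e) - conjR (u (embIter (j + 1) c'.src))⁻¹ (Nf j e)
          = conjR Gu (S j e - conjR (u (embIter j e.src))⁻¹ (Nf j e))
            + (conjR Gu (conjR (u (embIter j e.src))⁻¹ (Nf j e)) - conjR ((u (embIter (j + 1) c'.src))⁻¹ * u (embIter j e.src)) (conjR (u (embIter j e.src))⁻¹ (Nf j e))) := by
        rw [conjR_ref_conjR_inv, conjR_sub]; abel
      rw [hsplit]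
      have hA := norm_conjR_sub_conjR_ref_le (hu1 (embIter (j + 1) c'.src)) (hu1 (embIter j e.src)) hG1 (conjR (u (embIter j e.src))⁻¹ (Nf j e))
      rw [Units.val_mul] at hdef
      have hNn : ‖conjR (u (embIter j e.src))⁻¹ (Nf j e)‖ ≤ mf j e := by
        rw [norm_conjR ((U1 _).inv_mem (hu1 _)), hNf]
        show ‖((F.L : ℝ) ^ j) • bondAvgIter j (fun b => conjR (u b.src) (A b)) e‖ ≤ (F.L : ℝ) ^ j * bondAvgIter j (fun b => ‖A b‖) e
        rw [norm_smul, Real.norm_of_nonneg (by positivity)]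
        refine mul_le_mul_of_nonneg_left ((norm_bondAvgIter_le j _ e).trans (le_of_eq ?_)) (by positivity)
        congr 1; funext b; exact norm_conjR (hu1 _) (A b)
      have hmf0 : 0 ≤ mf j e := le_trans (norm_nonneg _) ihn
      calc ‖conjR Gu (S j e - conjR (u (embIter j e.src))⁻¹ (Nf j e))
            + (conjR Gu (conjR (u (embIter j e.src))⁻¹ (Nf j e)) - conjR ((u (embIter (j + 1) c'.src))⁻¹ * u (embIter j e.src)) (conjR (u (embIter j e.src))⁻¹ (Nf j e)))‖
          ≤ ‖conjR Gu (S j e - conjR (u (embIter j e.src))⁻¹ (Nf j e))‖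
            + ‖conjR Gu (conjR (u (embIter j e.src))⁻¹ (Nf j e)) - conjR ((u (embIter (j + 1) c'.src))⁻¹ * u (embIter j e.src)) (conjR (u (embIter j e.src))⁻¹ (Nf j e))‖ :=
            norm_add_le _ _
        _ ≤ θ * mf j e + 2 * (η' / 2) * mf j e := by
            refine add_le_add ?_ ?_
            · rw [norm_conjR hG1]; exact ihb
            · refine hA.trans ?_
              have h2 : 2 * ‖((u (embIter (j + 1) c'.src) : (Matrix (Fin 2) (Fin 2) ℂ)ˣ) : Matrix (Fin 2) (Fin 2) ℂ) * (Gu : Matrix (Fin 2) (Fin 2) ℂ) * (((u (embIter j e.src))⁻¹ : (Matrix (Fin 2) (Fin 2) ℂ)ˣ) : Matrix (Fin 2) (Fin 2) ℂ) - 1‖ ≤ 2 * (η' / 2) :=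
                mul_le_mul_of_nonneg_left hdef (by norm_num)
              exact mul_le_mul h2 hNn (norm_nonneg _) (by positivity)
        _ = (θ + η') * mf j e := by ring
    -- ★ assemble over the index set
    have hSrec : S (j + 1) c' = ((Fintype.card (Idx (F.P K)) : ℂ))⁻¹ • ∑ i : Idx (F.P K), ∑ t ∈ Finset.range (F.P K).L,
        ((holAt V (walk (emb c'.src) (stairWord i.2.1 (off i.1) ++ List.replicate t (c'.dir, true))) : Matrix.specialUnitaryGroup (Fin 2) ℂ) : Matrix (Fin 2) (Fin 2) ℂ)
          * S j ⟨runSite (Site.blockSite c'.src i.1) c'.dir t, c'.dir⟩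
          * star ((holAt V (walk (emb c'.src) (stairWord i.2.1 (off i.1) ++ List.replicate t (c'.dir, true))) : Matrix.specialUnitaryGroup (Fin 2) ℂ) : Matrix (Fin 2) (Fin 2) ℂ) := by
      rw [hSs j c']
      congr 1
      refine Finset.sum_congr rfl fun i _ => ?_
      rw [covWalkSum_walk_replicate_true, Finset.mul_sum, Finset.sum_mul]
      refine Finset.sum_congr rfl fun t _ => ?_
      rw [walk_append, holAt_append, walkEnd_emb_stairWord_eq_blockSite, ← hV]
      simp [StarMul.star_mul, mul_assoc]
    have hNrec : conjR (u (embIter (j + 1) c'.src))⁻¹ (Nf (j + 1) c')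
        = ((Fintype.card (Idx (F.P K)) : ℂ))⁻¹ • ∑ i : Idx (F.P K), ∑ t ∈ Finset.range (F.P K).L,
            conjR (u (embIter (j + 1) c'.src))⁻¹ (Nf j ⟨runSite (Site.blockSite c'.src i.1) c'.dir t, c'.dir⟩) := by
      have h := smul_bondAvgIter_succ_eq j (fun b => conjR (u b.src) (A b)) c'
      rw [hLL] at h
      simp only [hNf]
      rw [h, conjR_smul, conjR_sum]
      refine congrArg _ (Finset.sum_congr rfl fun i _ => ?_)
      rw [conjR_sum]
    have hmrec : mf (j + 1) c' = ((Fintype.card (Idx (F.P K)) : ℝ))⁻¹ * ∑ i : Idx (F.P K), ∑ t ∈ Finset.range (F.P K).L,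
        mf j ⟨runSite (Site.blockSite c'.src i.1) c'.dir t, c'.dir⟩ := by
      have h := mul_bondAvgIter_succ_eq j (fun b => ‖A b‖) c'
      rw [hLL] at h
      simp only [hmf]; exact h
    have hI0 : (0 : ℝ) < (Fintype.card (Idx (F.P K)) : ℝ) := by exact_mod_cast Fintype.card_pos
    have hnormI : ‖((Fintype.card (Idx (F.P K)) : ℂ))⁻¹‖ = ((Fintype.card (Idx (F.P K)) : ℝ))⁻¹ := by
      rw [norm_inv, Complex.norm_natCast]
    have hsum_le : ∀ (g : Idx (F.P K) → ℕ → Matrix (Fin 2) (Fin 2) ℂ) (bnd : Idx (F.P K) → ℕ → ℝ),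
        (∀ i t, t < (F.P K).L → ‖g i t‖ ≤ bnd i t) →
        ‖((Fintype.card (Idx (F.P K)) : ℂ))⁻¹ • ∑ i : Idx (F.P K), ∑ t ∈ Finset.range (F.P K).L, g i t‖
          ≤ ((Fintype.card (Idx (F.P K)) : ℝ))⁻¹ * ∑ i : Idx (F.P K), ∑ t ∈ Finset.range (F.P K).L, bnd i t := by
      intro g bnd hg
      rw [norm_smul, hnormI]
      refine mul_le_mul_of_nonneg_left ((norm_sum_le _ _).trans (Finset.sum_le_sum fun i _ => (norm_sum_le _ _).trans
        (Finset.sum_le_sum fun t ht => hg i t (Finset.mem_range.mp ht)))) (inv_nonneg.mpr hI0.le)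
    refine ⟨?_, ?_⟩
    · -- the defect row at level `j+1`
      rw [Finset.sum_range_succ, ← hη']
      show ‖S (j + 1) c' - conjR (u (embIter (j + 1) c'.src))⁻¹ (Nf (j + 1) c')‖ ≤ (θ + η') * mf (j + 1) c'
      rw [hSrec, hNrec, ← smul_sub]
      simp only [← Finset.sum_sub_distrib]
      refine (hsum_le _ (fun i t => (θ + η') * mf j ⟨runSite (Site.blockSite c'.src i.1) c'.dir t, c'.dir⟩) (fun i t ht => hterm i t ht)).trans ?_
      rw [hmrec, Finset.mul_sum, Finset.mul_sum]
      refine le_of_eq ?_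
      simp only [Finset.mul_sum]
      refine Finset.sum_congr rfl fun i _ => Finset.sum_congr rfl fun t _ => ?_
      ring
    · -- the mass row at level `j+1`
      show ‖S (j + 1) c'‖ ≤ mf (j + 1) c'
      rw [hSrec]
      refine (hsum_le _ (fun i t => mf j ⟨runSite (Site.blockSite c'.src i.1) c'.dir t, c'.dir⟩) (fun i t ht => ?_)).trans (le_of_eq hmrec.symm)
      calc _ ≤ ‖((holAt V (walk (emb c'.src) (stairWord i.2.1 (off i.1) ++ List.replicate t (c'.dir, true))) : Matrix.specialUnitaryGroup (Fin 2) ℂ) : Matrix (Fin 2) (Fin 2) ℂ)‖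
              * ‖S j ⟨runSite (Site.blockSite c'.src i.1) c'.dir t, c'.dir⟩‖
              * ‖star ((holAt V (walk (emb c'.src) (stairWord i.2.1 (off i.1) ++ List.replicate t (c'.dir, true))) : Matrix.specialUnitaryGroup (Fin 2) ℂ) : Matrix (Fin 2) (Fin 2) ℂ)‖ :=
            (norm_mul_le _ _).trans (mul_le_mul_of_nonneg_right (norm_mul_le _ _) (norm_nonneg _))
        _ ≤ 1 * mf j ⟨runSite (Site.blockSite c'.src i.1) c'.dir t, c'.dir⟩ * 1 := by
            rw [Prop7HolRatioPerStep.norm_coe_eq_one, Prop7HolRatioPerStep.norm_star_coe_eq_one]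
            exact mul_le_mul_of_nonneg_right (mul_le_mul_of_nonneg_left (hIH i.1 t ht).2 zero_le_one) zero_le_one
        _ = _ := by ring

end Summit.QuantumFields.YangMills.Theorems.Prop7TubeStrLineIterRefMean

end
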